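import Literature.MathematicalPhysics.QuantumFieldTheory.Balaban1983to89.B9Eq3105FamThreeRecordsD1Closed
import Literature.MathematicalPhysics.QuantumFieldTheory.Balaban1983to89.B9Eq3105FamThreeLocCDiffEntry

/-!
# `Balaban1983to89.B9Eq3105FamThreeTAtLocCfgOfTails` — FAMILY 3 OF (3.105): THE TRANSPOSED (`hV′`) RECORD AT `χl_□` WITH `hDL`, `hDR` AND `hP3` SUPPLIED — the
# twin of p33's FILE 7 `B9Eq3105FamThreeAtLocCfgOfTails` for the other record: p38 PT-v2 `B9Eq3105FamThreeRecordsD1Closed.hasMajorant_sum_famThreeT_at_locCfg_chiL`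
# (D1 closed both sides) with its displayed D2 entry `hP3 □` FED by p33's FILE 6 `B9Eq3105FamThreeLocCDiffEntry.hasMajorant_hP3_of_tails` LITERALLY (the `hP3 □`
# operator is the same in both records — F3-PT's third summand is not transposed), folded to `ε₃·ℓ(a)⁻²·e^{−ρd}` by `(d+1)·ε_{P3} ≤ ε₃`, `ρ ≤ r₀ − 5(α_w+β_w)δ₀^w −
# a_sep^w` exactly as FILE 7 does (sub-row G-B9-LETTERS, GAPS G-B9-05 ∕ G-B9-p33-01, programme FAMTHREE; lead g35 RULING FAMTHREE-6 «each lineage plugs its own record»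
# and word 06:13Z «the larger optional item after E3f»; seat p38 gen 48)

T. Bałaban, *Propagators for lattice gauge theories in a background field*, Commun. Math. Phys. **99** (1985) 389–434 [`Balaban1985BackgroundPropagators`, "[B9]"];
[4] = T. Bałaban, *Propagators and renormalization transformations for lattice gauge theories. II*, Commun. Math. Phys. **96** (1984) 223–250 [`Balaban1984PropagatorsII`];
[2] of [B9] = T. Bałaban, *Regularity and decay of lattice Green's functions*, Commun. Math. Phys. **89** (1983) 571–597 [`Balaban1983RegularityDecay`].

statement-level skeleton of published theorems with citation tags; proofs where landed; nothing here is a claim about the Yang–Mills mass gap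

THE PRINTED LOCUS (held `paper:balaban1985-cmp99-background-propagators`, journal page = PDF page + 388).  (3.105)–(3.106) p. 414 (the third sum of the expansion of
`G(U₁) − G_appr`) and p. 415 l. 26–37, in particular l. 29–31 «Next we replace the operators G′_{□₀} and C_{□₀} by G′_□, C_□, terms with the differences G′_{□₀} − G′_□
and C_{□₀} − C_□ are small by the same reason as before»; p. 412 l. 22–36 («the operators may differ outside □̃₀, and the distance from □̃ to □̃₀ᶜ is at least M»);
(3.95) p. 411; (3.100) p. 413; (3.88)–(3.89) p. 409; Cor. 3.6 p. 408 («U′ = U^u = e^{iηA}»); Thm 3.1 (3.42) p. 397; (3.48)–(3.49) pp. 398–399; (3.87) p. 409; (3.91)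
p. 410; [4] (2.51)–(2.55) pp. 232–233, (2.46) p. 231, Lemma 2.1 (2.60)–(2.61) p. 234, (2.83)–(2.85) pp. 237–238; [2] (1.11)–(1.12) (statement type only).

WHY THIS FILE.  After PT-v2 (p700265) the transposed family-3 record displays, of the three located entries, only the D2 entry `hP3 □` = `conj b((∇_{U₁}∘(M_{χl_□}∘(G′_□(V′_□)
∘(S(U₁) − S_□(V′_□))∘G′_□(V′_□))∘M_{χl_□})∘∇*_{U₁})^ℝ) ≺ ε₃·ℓ(a)⁻²·e^{−ρd}` over `(toB6 (geo9K i) Rr Hp, ιB∘blkV1)`, `V′_□ = Ṽ_□^{u⁻¹}`, `S = Q′*X⁻¹Q′` — the SAME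
operator as in the `hrest` record (checked on the tree texts: PT-v2's binder = E2d's binder up to the member-carrier letters).  p33 g104's FILE 6
`hasMajorant_hP3_of_tails` proves exactly this operator's majorant per cube from the consumer's standing data plus its displayed cube words ∕ tails ∕ outer entries at
`V′_□` (`hLw`, `hRop`, `hTail0∕1∕2`, `hSbL`, `hGw`, `hPb` — p33's FILES 8a∕8b∕8c supply them), and p33's FILE 7 plugs it into the `hrest` record.  THIS FILE is the
same plug for the `hV′` record: PT-v2's binder list with `hε₃`∕`hP3 □` REPLACED by FILE 7's FILE-6 block (`hX`, `hXc □`, `dBw`, the `κ`'s, `C`'s, rates and budgets, the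
five transfers, the member (2.61) at `(δ₀^w, β_w)`, `hLw`, `hRop`, `hTail0∕1∕2`, `hSbL`, `hGw`, `hPb`) and the two folds `hε₃w`, `hρw`, copied from the TREE text of FILE
7 with the member-carrier letters renamed `Rr′ Hp ↦ Rr Hp`; same conclusion as PT-v2.  Generated mechanically from the two tree files (seat folder
`tools/gen_hv_tails.py`), so the displayed block is FILE 7's byte for byte.

WHAT THIS FILE CERTIFIES (kernel-checked; 0 `def`, 0 `def … : Prop`, 0 sorry; standard axioms only)
* ★★★ `hasMajorant_sum_famThreeT_at_locCfg_of_tails` — the transposed (`hV′`) family-3 sum at the located projection letters and `χl_□` over `(toB6 (geo9K i) Rr Hp,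
  ιB∘blkOf)` with PT-v2's kernel, ALL THREE located entries supplied: `hDL` (p33 E2d), `hDR` (p38 E3c, `hGK` closed), `hP3` (p33 FILE 6); displayed: `hE`∕`hEO`∕`hCinv`,
  the cube-side letters `hR □`∕`hT □` (∃-supplied by p33 E2e ∕ p38 E3c; one package: p38 E3f `commSteps_at_datum`), the four units `hU`, `hV □`, `hX`, `hXc □`,
  `η = |c_f|⁻¹`, the (3.35) data, F3-PT's cube datum `hPlC □`, FILE 6's cube words ∕ tails ∕ outer entries, the transfers, the cube and member (2.61)'s and the budgets.

HONEST SCOPE ∕ NOT CLAIMED.  A plug of two landed theorems (PT-v2, FILE 6) in FILE 7's pattern — no new inequality of [B9].  What the `hV′` record still displays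
after this file is the list above (FILE 6's words are p33's FILES 8a∕8b∕8c; the ∃-packaging over the thresholds is the assembler's).  Count-neutral; NOT a node
discharge; no summit ∕ sub-problem statement is proved; nothing continuum ∕ OS ∕ mass-gap ∕ Clay; YM mass gap NOT proved (Track A conditional rung).  No `sorry`, no
`axiom`, no `… : Prop` fact, no `instance`, no `notation`, no `def`.  NEW file; nothing landed is modified.  Cell `lit-balaban`, seat `lit-balaban-p38` gen 48,
2026-08-29; `--supports stmt-QuantumFields-19200`.  Net new unproved facts: 0.

RELATED IN THE TREE, NOT DUPLICATED (searched 2026-08-29: `rg 'famThreeT_at_locCfg_of_tails|FamThreeTAtLocCfgOfTails' Literature/` = nothing): p33 FILE 7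
`B9Eq3105FamThreeAtLocCfgOfTails` (the `hrest` twin — the pattern followed line by line) and FILE 6 `B9Eq3105FamThreeLocCDiffEntry`, p38 PT-v2
`B9Eq3105FamThreeRecordsD1Closed`, p38 `B9Eq3105FamThreeAtLocCfgOfTailsClosed` — USED BY NAME.
-/

noncomputable section

namespace Literature.MathematicalPhysics.QuantumFieldTheory.Balaban1983to89.B9Eq3105FamThreeTAtLocCfgOfTails

open NormedSpace Complex
open B6RandomWalk (HasMajorant hasMajorant_mono Ineq261 c1_nonneg)
open B9Thm34Ext (toB6)
open B9Thm37Sum (mulOp mulOp_apply)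
open B9FromB6 (EBlock)
open B9Ineq347 (ScaleTransfer)
open B9Eq352DivFormLetters (conj)
open B9Eq352GradLetters (diffLetter)
open B9Eq39Adjoint (fluct)
open B9Eq360DeltaPrimeAY (AfldY)
open B9Eq360DeltaPrimeACubeY (blkCubeY)
open B6KLevelCensusIndexV1 (KIdx kGeo)
open B6Cover236MultiLevelBlocks (cubes)
open B6GlobalChartV1 (PV boxEquiv blkV1)
open B6Geom246MultiLevelBox (blkOf)
open B6Ineq2142KLevelV1 (β)
open B9GeoNormsKLevelV1 (geo9K)
open B9GeoLemma21KLevelV1 (geo9K_len_pos)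
open B9CubeGeometryInputs (geoCK)
open B9Cor35GCubeInputsAtOne (blkBK)
open B9CubeLettersOpsL0 (deltaPrimeACubeY GpCubeY)
open B9CubeLettersBondOpsL0 (QpCubeY QpsCubeY XCubeY XinvCubeY)
open B9CubeLettersInvReadings (kernelFamilySInv kernelFamilyBInv)
open B9Thm37CubeCoverCommutators (cutMulY hTY)
open B4PartitionUnity22 (thetaProf D1)
open B9Cor36CutoffField337 (bumpY)
open B9Cor36CubeCutoffs (SC NearC chiY ctrR locCfgY)
open B9Eq3105FamTwoCore (geo9K_axioms)
open B9Eq3104CutoffCommutators (hBdY DPDsY)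
open B9Eq3105AtLetters (DPDsCubeY)
open B9Eq3105ZetaY (zetaY)
open B9Cor36GCubeLocLetter (locProjBY)
open B9Thm39CinvAtCover (DsepT)
open B9Ineq368PPrime (kappa349)
open B9Eq3105FamThreeRecordsD1Closed (hasMajorant_sum_famThreeT_at_locCfg_chiL)
open B9Eq3105FamThreeLocCDiffEntry (hasMajorant_hP3_of_tails)
open Node00 (SiteY BlkY IBondY FBondY CfgY GaugeY SiteOpY BondOpY SiteParY BondParY toKT etaS shiftY UboxY QpY QpsY XY XinvY gradY divY gradK gaugeY parSymY
  GpY deltaPrimeAY)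

variable {d ℓ : ℕ} {hd : 1 ≤ d + 1} {hL : Odd (ℓ + 1) ∧ 1 < ℓ + 1} {b₀ b₁ : ℝ}
variable {𝔸 : Type} [NormedRing 𝔸] [NormedAlgebra ℂ 𝔸] [CompleteSpace 𝔸]
variable {ι : Type} [Fintype ι]
variable (i : KIdx d ℓ hd hL b₀ b₁) (b : Module.Basis ι ℝ 𝔸)

section Record

variable [Fintype (geo9K i).Site] [DecidableEq (geo9K i).Site] {Rr : ℝ} {Hp : Prop}
variable {B : B9.Backgrounds} (cfg : B.Cfg → CfgY 𝔸 i) (par : BondParY 𝔸 i) {U₁ : B.Cfg}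

open Classical in
set_option maxHeartbeats 12800000 in
/-- ★★★ **THE TRANSPOSED (`hV′`) FAMILY-3 RECORD AT `χl_□` WITH `hDL`, `hDR`, `hP3` SUPPLIED**: PT-v2 `hasMajorant_sum_famThreeT_at_locCfg_chiL` with `hP3 □` := p33 FILE 6
`hasMajorant_hP3_of_tails` at `u := u □`, `A := A □` (cube letters `RC HC`, member letters `Rr Hp`), folded to `ε₃·ℓ(a)⁻²·e^{−ρd}` by `hε₃w`, `hρw`; displayed instead of
`hP3 □`: FILE 7's FILE-6 block verbatim (the units `hX`, `hXc □`, the words' budgets ∕ rates ∕ transfers, the member (2.61) at `(δ₀^w, β_w)`, `hLw`, `hRop`, `hTail0∕1∕2`,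
`hSbL`, `hGw`, `hPb`); everything else as in PT-v2; same conclusion.
[cite: Balaban1985BackgroundPropagators, (3.105) p.414, p.415 l.26–37, p.412 l.22–36, (3.95) p.411, (3.100) p.413, Cor. 3.6 p.408, (3.42) p.397, (3.48)–(3.49) pp.398–399, (3.87)–(3.89) p.409, (3.91) p.410; Balaban1983RegularityDecay, (1.11)–(1.12) (statement type); Balaban1984PropagatorsII, (2.51)–(2.55) p.232, (2.46) p.231, (2.83)–(2.85) pp.237–238, Lemma 2.1 (2.60)–(2.61) p.234] -/
theorem hasMajorant_sum_famThreeT_at_locCfg_of_tails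
    {BG δG : ℝ} (hE : EBlock (kernelFamilySInv i B cfg (fun W => GpY i (parSymY i) W) (parSymY i)) BG δG U₁) (hBG : 0 ≤ BG) (hδG0 : 0 ≤ δG)
    (Oc : ↥(cubes i.D.toDomains) → BondOpY 𝔸 i) {B₀ δ : ℝ} (hB₀ : 0 ≤ B₀) (hδ : 0 < δ)
    (hEO : ∀ c : ↥(cubes i.D.toDomains), EBlock (kernelFamilyBInv i B cfg (Oc c) par) B₀ δ U₁)
    (ιB : BlkY i → IBondY i) (hι : ∀ s, β i.hN i.D i.hk (ιB s) = s)
    (hpar : ∀ z w : SiteY i, ‖(parSymY i (cfg U₁) z w : 𝔸)‖ ≤ 1 ∧ ‖(((parSymY i (cfg U₁) z w)⁻¹ : 𝔸ˣ) : 𝔸)‖ ≤ 1)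
    {M₂ : ℝ} (hM₂ : 0 ≤ M₂) (hrepr : ∀ (v : 𝔸) (j : ι), |b.repr v j| ≤ M₂ * ‖v‖) (hη : etaS i = |i.cf|⁻¹)
    {s B₁ δX : ℝ} (hs : (etaS i ^ 2 * etaS i ^ 2) * s = 1) (hB₁ : 0 ≤ B₁)
    (hCinv : HasMajorant (g := toB6 (geo9K i) Rr Hp) (fun q : BlkY i × ι => ιB q.1) (conj b (s • (XinvY i (parSymY i) (fun W => GpY i (parSymY i) W) (cfg U₁)).restrictScalars ℝ))
      (fun a a' => B₁ * ((geo9K i).len a ^ 4)⁻¹ * Real.exp (-(δX * (geo9K i).dist a a'))))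
    (u : ↥(cubes i.D.toDomains) → GaugeY 𝔸 i) (hu : ∀ c x, ‖((u c x : 𝔸ˣ) : 𝔸)‖ ≤ 1 ∧ ‖(((u c x)⁻¹ : 𝔸ˣ) : 𝔸)‖ ≤ 1)
    (A : ↥(cubes i.D.toDomains) → AfldY 𝔸 i)
    (Q : ↥(cubes i.D.toDomains) → Set (Site (PV d ℓ i.m i.K hd hL) 0)) (η : ℝ)
    (hQ : ∀ (c : ↥(cubes i.D.toDomains)) (x : Site (PV d ℓ i.m i.K hd hL) 0), NearC i c (35 * SC i c / 8 + 1) (boxEquiv i.hN x).1 → x ∈ Q c)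
    (hgA : ∀ (c : ↥(cubes i.D.toDomains)) (κ : Fin (d + 1)) (x : Site (PV d ℓ i.m i.K hd hL) 0), x ∈ Q c → x.shift κ ∈ Q c →
      gaugeY i (u c) (cfg U₁) κ x = fluct η (A c) κ x)
    (hU : IsUnit (deltaPrimeAY i (parSymY i) (cfg U₁)))
    (hV : ∀ c : ↥(cubes i.D.toDomains), IsUnit (deltaPrimeACubeY i c (parSymY i) (gaugeY i (u c)⁻¹ (locCfgY i c η (A c)))))
    (RC : ℝ) (HC : Prop)
    (dBc dBE : ℕ) {θ δc αc asepE ρE bb : ℝ} (hθ : 0 ≤ θ) (hδc : 0 ≤ δc) (hαc1 : αc ≤ 1) (hasepE : 0 ≤ asepE) (hρE : 0 ≤ ρE) (hsplitE : asepE + ρE ≤ 1)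
    (hrate : bb * δG ≤ (1 - αc) * δc) (h261c : ∀ c : ↥(cubes i.D.toDomains), Ineq261 dBc (toB6 (geoCK i c) RC HC) δc αc)
    (h261E : Ineq261 dBE (toB6 (geo9K i) Rr Hp) δG (bb - ρE))
    (hR : ∀ c : ↥(cubes i.D.toDomains), HasMajorant (g := toB6 (geoCK i c) RC HC) (fun p : SiteY i × ι => blkCubeY i c p.1)
      (conj b (((cutMulY (𝔸 := 𝔸) (chiY i c) * deltaPrimeACubeY i c (parSymY i) (locCfgY i c η (A c)) -
          deltaPrimeACubeY i c (parSymY i) (locCfgY i c η (A c)) * cutMulY (𝔸 := 𝔸) (chiY i c)) * GpCubeY i c (parSymY i) (locCfgY i c η (A c))).restrictScalars ℝ))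
      (fun a s' => θ * Real.exp (-(δc * (geoCK i c).dist a s'))))
    {εT δT : ℝ}
    (hεDT : (M₂ * (∑ j, ‖b j‖) * BG * (1 + D1 thetaProf / 3)) *
          (Real.exp (-(asepE * δG * (3 / 8 * (i.Mh : ℝ) - 1))) +
            ((M₂ * ∑ j, ‖b j‖) ^ 2 * (θ * B6.c1 dBc δc αc)) * B6.c1 dBE δG (bb - ρE) * Real.exp (-(asepE * δG * (3 / 8 * (i.Mh : ℝ) - 2)))) ≤ εT)
    (hδDT : δT ≤ ρE * δG)
    (dBt : ℕ) {θt δt αt : ℝ} (hθt : 0 ≤ θt) (hδt : 0 ≤ δt) (hαt1 : αt ≤ 1)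
    (h261t : ∀ c : ↥(cubes i.D.toDomains), Ineq261 dBt (toB6 (geoCK i c) RC HC) δt αt)
    (hT : ∀ c : ↥(cubes i.D.toDomains), HasMajorant (g := toB6 (geoCK i c) RC HC) (fun p : SiteY i × ι => blkCubeY i c p.1)
      (conj b ((GpCubeY i c (parSymY i) (locCfgY i c η (A c)) * (deltaPrimeACubeY i c (parSymY i) (locCfgY i c η (A c)) * cutMulY (𝔸 := 𝔸) (chiY i c) -
          cutMulY (𝔸 := 𝔸) (chiY i c) * deltaPrimeACubeY i c (parSymY i) (locCfgY i c η (A c)))).restrictScalars ℝ))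
      (fun a s' => θt * Real.exp (-(δt * (geoCK i c).dist a s'))))
    (dBR : ℕ) {δ₀R aG αR ΛR bK αstR ΛstR asepR ρR : ℝ} (hδ₀R : 0 ≤ δ₀R) (haG : aG * δ₀R ≤ δG) (hαR : 0 ≤ αR) (hΛR : 0 ≤ ΛR)
    (hT1R : ScaleTransfer (geo9K i) δ₀R αR ΛR (fun a => (geo9K i).len a)) (hΛstR : 0 ≤ ΛstR)
    (hTstR : ScaleTransfer (geo9K i) δ₀R αstR ΛstR (fun a => (geo9K i).len a)) (hasepR : 0 ≤ asepR) (hρR : 0 ≤ ρR) (hsplitL : αstR + ρR ≤ bK)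
    (hrateR : bK * δ₀R ≤ (1 - αt) * δt) (hsplitR : αR + asepR + ρR ≤ aG) (h261R : Ineq261 dBR (toB6 (geo9K i) Rr Hp) δ₀R (aG - αR - asepR - ρR))
    (hεRT : (M₂ * (∑ j, ‖b j‖) * BG * (1 + ΛR * (D1 thetaProf / 3)) *
          (Real.exp (-(asepR * δ₀R * (3 / 8 * (i.Mh : ℝ) - 1))) +
            ((M₂ * ∑ j, ‖b j‖) ^ 2 * (θt * B6.c1 dBt δt αt)) * ΛstR * B6.c1 dBR δ₀R (aG - αR - asepR - ρR) *
              Real.exp (-(asepR * δ₀R * (3 / 8 * (i.Mh : ℝ) - 3))))) ≤ εT)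
    (hδRT : δT ≤ ρR * δ₀R)
    -- F3-B3 (p33's lane, FILE 6 `hasMajorant_hP3_of_tails`, displayed exactly as in p33's FILE 7): the four units, budgets, and the displayed cube tails ∕ outer entries at `V′_□`
    (hX : IsUnit (XY i (parSymY i) (fun W => GpY i (parSymY i) W) (cfg U₁)))
    (hXc : ∀ c : ↥(cubes i.D.toDomains), IsUnit (XCubeY i c (parSymY i) (gaugeY i (u c)⁻¹ (locCfgY i c η (A c)))))
    (dBw : ℕ) {κL κPb κT0 κT1 κT2 κSb κR κG r₀ rT0 rT1 rT2 rSb rR rG δ₀w αw βw asepw CS CA CT3 CT1 C1 : ℝ}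
    (hκL : 0 ≤ κL) (hκPb : 0 ≤ κPb) (hκT0 : 0 ≤ κT0) (hκT1 : 0 ≤ κT1) (hκT2 : 0 ≤ κT2) (hκSb : 0 ≤ κSb) (hκR : 0 ≤ κR) (hκG : 0 ≤ κG)
    (hCS : 0 ≤ CS) (hCA : 0 ≤ CA) (hCT3 : 0 ≤ CT3) (hCT1 : 0 ≤ CT1) (hC1 : 0 ≤ C1)
    (hαδw : 0 ≤ αw * δ₀w) (hε0w : 0 ≤ (αw + βw) * δ₀w) (hasepw : 0 ≤ asepw) (hρw0 : 0 ≤ r₀ - 5 * ((αw + βw) * δ₀w) - asepw)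
    (hrSw : r₀ - (αw + βw) * δ₀w ≤ δX) (hrAw : r₀ - 2 * ((αw + βw) * δ₀w) ≤ δG) (hrcw : r₀ - 3 * ((αw + βw) * δ₀w) - asepw ≤ bb * δG)
    (hrT0 : r₀ - 4 * ((αw + βw) * δ₀w) - asepw ≤ rT0) (hrT1 : r₀ - 4 * ((αw + βw) * δ₀w) - asepw ≤ rT1) (hrT2 : r₀ - 2 * ((αw + βw) * δ₀w) - asepw ≤ rT2)
    (hrSb : r₀ - (αw + βw) * δ₀w ≤ rSb) (hrR : r₀ - 2 * ((αw + βw) * δ₀w) - asepw ≤ rR) (hrG : r₀ - 5 * ((αw + βw) * δ₀w) - asepw ≤ rG)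
    (hST4w : ScaleTransfer (geo9K i) δ₀w αw CS (fun a => ((geo9K i).len a ^ 4)⁻¹)) (hST2w : ScaleTransfer (geo9K i) δ₀w αw CA (fun a => (geo9K i).len a ^ 2))
    (hST3w : ScaleTransfer (geo9K i) δ₀w αw CT3 (fun a => ((geo9K i).len a ^ 3)⁻¹)) (hSTm1w : ScaleTransfer (geo9K i) δ₀w αw CT1 (fun a => ((geo9K i).len a)⁻¹))
    (hST1w : ScaleTransfer (geo9K i) δ₀w αw C1 (fun a => (geo9K i).len a)) (h261w : Ineq261 dBw (toB6 (geo9K i) Rr Hp) δ₀w βw)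
    (hLw : ∀ (c : ↥(cubes i.D.toDomains)) (μ : Fin (d + 1)), HasMajorant (g := toB6 (geo9K i) Rr Hp) (fun p : SiteY i × ι => ιB (blkOf i.D.toDomains p.1))
      (conj b (diffLetter (shiftY i) (UboxY i (cfg U₁)) (((etaS i : ℝ) : ℂ))⁻¹ (Sum.inl μ)) * mulOp (fun p : SiteY i × ι => bumpY i (ctrR i c) (3 * (SC i c : ℝ)) p.1) *
        conj b (((((etaS i ^ 2 : ℝ) : ℂ)) • GpCubeY i c (parSymY i) (gaugeY i (u c)⁻¹ (locCfgY i c η (A c)))).restrictScalars ℝ))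
      (fun a a' : (geo9K i).Site => (if a ∈ (Finset.univ.filter fun a : (geo9K i).Site => ∃ z : SiteY i, ιB (blkOf i.D.toDomains z) = a ∧ NearC i c (21 * SC i c / 8 + 1) z.1)
        then (1 : ℝ) else 0) * (κL * (geo9K i).len a * Real.exp (-(r₀ * (geo9K i).dist a a')))))
    (hRop : ∀ (c : ↥(cubes i.D.toDomains)) (ν : Fin (d + 1)), HasMajorant (g := toB6 (geo9K i) Rr Hp) (fun p : SiteY i × ι => ιB (blkOf i.D.toDomains p.1))
      (conj b (((((etaS i ^ 2 : ℝ) : ℂ)) • GpCubeY i c (parSymY i) (gaugeY i (u c)⁻¹ (locCfgY i c η (A c)))).restrictScalars ℝ) *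
        mulOp (fun p : SiteY i × ι => bumpY i (ctrR i c) (3 * (SC i c : ℝ)) p.1) * conj b (diffLetter (shiftY i) (UboxY i (cfg U₁)) (((etaS i : ℝ) : ℂ))⁻¹ (Sum.inr ν)))
      (fun a a' => κR * (geo9K i).len a * Real.exp (-(rR * (geo9K i).dist a a'))))
    (hTail0 : ∀ (c : ↥(cubes i.D.toDomains)) (ν : Fin (d + 1)), HasMajorant (g := toB6 (geo9K i) Rr Hp) (fun p : SiteY i × ι => ιB (blkOf i.D.toDomains p.1))
      (conj b ((((s : ℝ) : ℂ) • (QpsCubeY i c (parSymY i) (gaugeY i (u c)⁻¹ (locCfgY i c η (A c))) ∘ₗ XinvCubeY i c (parSymY i) (gaugeY i (u c)⁻¹ (locCfgY i c η (A c))) ∘ₗ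
            QpCubeY i c (parSymY i) (gaugeY i (u c)⁻¹ (locCfgY i c η (A c))))).restrictScalars ℝ) *
        mulOp (fun p : SiteY i × ι => if NearC i c (3 * SC i c) p.1.1 then (1 : ℝ) else 0) *
        (conj b (((((etaS i ^ 2 : ℝ) : ℂ)) • GpCubeY i c (parSymY i) (gaugeY i (u c)⁻¹ (locCfgY i c η (A c)))).restrictScalars ℝ) *
          mulOp (fun p : SiteY i × ι => bumpY i (ctrR i c) (3 * (SC i c : ℝ)) p.1) * conj b (diffLetter (shiftY i) (UboxY i (cfg U₁)) (((etaS i : ℝ) : ℂ))⁻¹ (Sum.inr ν))))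
      (fun a a' => κT0 * ((geo9K i).len a ^ 3)⁻¹ * Real.exp (-(rT0 * (geo9K i).dist a a'))))
    (hTail1 : ∀ (c : ↥(cubes i.D.toDomains)) (ν : Fin (d + 1)), HasMajorant (g := toB6 (geo9K i) Rr Hp) (fun p : SiteY i × ι => ιB (blkOf i.D.toDomains p.1))
      (conj b (((((etaS i ^ 2 : ℝ) : ℂ)) • GpCubeY i c (parSymY i) (gaugeY i (u c)⁻¹ (locCfgY i c η (A c)))).restrictScalars ℝ) *
        (conj b ((((s : ℝ) : ℂ) • (QpsCubeY i c (parSymY i) (gaugeY i (u c)⁻¹ (locCfgY i c η (A c))) ∘ₗ XinvCubeY i c (parSymY i) (gaugeY i (u c)⁻¹ (locCfgY i c η (A c))) ∘ₗ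
            QpCubeY i c (parSymY i) (gaugeY i (u c)⁻¹ (locCfgY i c η (A c))))).restrictScalars ℝ) *
          mulOp (fun p : SiteY i × ι => if NearC i c (3 * SC i c) p.1.1 then (1 : ℝ) else 0) *
          (conj b (((((etaS i ^ 2 : ℝ) : ℂ)) • GpCubeY i c (parSymY i) (gaugeY i (u c)⁻¹ (locCfgY i c η (A c)))).restrictScalars ℝ) *
          mulOp (fun p : SiteY i × ι => bumpY i (ctrR i c) (3 * (SC i c : ℝ)) p.1) * conj b (diffLetter (shiftY i) (UboxY i (cfg U₁)) (((etaS i : ℝ) : ℂ))⁻¹ (Sum.inr ν)))))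
      (fun a a' => κT1 * ((geo9K i).len a)⁻¹ * Real.exp (-(rT1 * (geo9K i).dist a a'))))
    (hTail2 : ∀ (c : ↥(cubes i.D.toDomains)) (ν : Fin (d + 1)), HasMajorant (g := toB6 (geo9K i) Rr Hp) (fun p : SiteY i × ι => ιB (blkOf i.D.toDomains p.1))
      (conj b (((((etaS i ^ 2 : ℝ) : ℂ)) • GpCubeY i c (parSymY i) (gaugeY i (u c)⁻¹ (locCfgY i c η (A c)))).restrictScalars ℝ) *
        conj b (((((etaS i ^ 2 : ℝ) : ℂ)) • GpCubeY i c (parSymY i) (gaugeY i (u c)⁻¹ (locCfgY i c η (A c)))).restrictScalars ℝ) *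
        (conj b ((((s : ℝ) : ℂ) • (QpsCubeY i c (parSymY i) (gaugeY i (u c)⁻¹ (locCfgY i c η (A c))) ∘ₗ XinvCubeY i c (parSymY i) (gaugeY i (u c)⁻¹ (locCfgY i c η (A c))) ∘ₗ
            QpCubeY i c (parSymY i) (gaugeY i (u c)⁻¹ (locCfgY i c η (A c))))).restrictScalars ℝ) *
          mulOp (fun p : SiteY i × ι => if NearC i c (3 * SC i c) p.1.1 then (1 : ℝ) else 0) *
          (conj b (((((etaS i ^ 2 : ℝ) : ℂ)) • GpCubeY i c (parSymY i) (gaugeY i (u c)⁻¹ (locCfgY i c η (A c)))).restrictScalars ℝ) *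
          mulOp (fun p : SiteY i × ι => bumpY i (ctrR i c) (3 * (SC i c : ℝ)) p.1) * conj b (diffLetter (shiftY i) (UboxY i (cfg U₁)) (((etaS i : ℝ) : ℂ))⁻¹ (Sum.inr ν)))))
      (fun a a' => κT2 * (geo9K i).len a * Real.exp (-(rT2 * (geo9K i).dist a a'))))
    (hSbL : ∀ c : ↥(cubes i.D.toDomains), HasMajorant (g := toB6 (geo9K i) Rr Hp) (fun p : SiteY i × ι => ιB (blkOf i.D.toDomains p.1))
      (mulOp (fun p : SiteY i × ι => if NearC i c (3 * SC i c) p.1.1 then (1 : ℝ) else 0) *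
        conj b ((((s : ℝ) : ℂ) • (QpsCubeY i c (parSymY i) (gaugeY i (u c)⁻¹ (locCfgY i c η (A c))) ∘ₗ XinvCubeY i c (parSymY i) (gaugeY i (u c)⁻¹ (locCfgY i c η (A c))) ∘ₗ
            QpCubeY i c (parSymY i) (gaugeY i (u c)⁻¹ (locCfgY i c η (A c))))).restrictScalars ℝ))
      (fun a a' => κSb * ((geo9K i).len a ^ 4)⁻¹ * Real.exp (-(rSb * (geo9K i).dist a a'))))
    (hGw : ∀ (c : ↥(cubes i.D.toDomains)) (ν : Fin (d + 1)), HasMajorant (g := toB6 (geo9K i) Rr Hp) (fun p : SiteY i × ι => ιB (blkOf i.D.toDomains p.1))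
      (conj b ((((s : ℝ) : ℂ) • (QpsCubeY i c (parSymY i) (gaugeY i (u c)⁻¹ (locCfgY i c η (A c))) ∘ₗ XinvCubeY i c (parSymY i) (gaugeY i (u c)⁻¹ (locCfgY i c η (A c))) ∘ₗ
            QpCubeY i c (parSymY i) (gaugeY i (u c)⁻¹ (locCfgY i c η (A c))))).restrictScalars ℝ) *
        (conj b (((((etaS i ^ 2 : ℝ) : ℂ)) • GpCubeY i c (parSymY i) (gaugeY i (u c)⁻¹ (locCfgY i c η (A c)))).restrictScalars ℝ) *
          mulOp (fun p : SiteY i × ι => bumpY i (ctrR i c) (3 * (SC i c : ℝ)) p.1) * conj b (diffLetter (shiftY i) (UboxY i (cfg U₁)) (((etaS i : ℝ) : ℂ))⁻¹ (Sum.inr ν))))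
      (fun a a' => κG * ((geo9K i).len a ^ 3)⁻¹ * Real.exp (-(rG * (geo9K i).dist a a'))))
    (hPb : ∀ c : ↥(cubes i.D.toDomains), HasMajorant (g := toB6 (geo9K i) Rr Hp) (fun p : SiteY i × ι => ιB (blkOf i.D.toDomains p.1))
      (conj b ((QpsCubeY i c (parSymY i) (gaugeY i (u c)⁻¹ (locCfgY i c η (A c))) ∘ₗ QpCubeY i c (parSymY i) (gaugeY i (u c)⁻¹ (locCfgY i c η (A c)))).restrictScalars ℝ))
      (fun a a' : (geo9K i).Site => if a = a' then κPb else 0))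
    (dB : ℕ) {δ₀ δP α β' ρ Λ : ℝ} (hΛ : 1 ≤ Λ) (hρ : 0 ≤ ρ) (hα : 0 ≤ α) (hβ : 0 ≤ β') (hδ₀ : 0 ≤ δ₀)
    (hδG' : δP ≤ δG) (hδX' : δP ≤ δX) (hδD' : δP ≤ δT) (hr : ρ + (2 * α + β') * δ₀ ≤ δP)
    (h261 : Ineq261 dB (toB6 (geo9K i) Rr Hp) δ₀ β')
    (hT1 : ScaleTransfer (geo9K i) δ₀ α Λ (fun a => (geo9K i).len a)) (hT2 : ScaleTransfer (geo9K i) δ₀ α Λ (fun a => (geo9K i).len a ^ 2))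
    (hT4 : ScaleTransfer (geo9K i) δ₀ α Λ (fun a => ((geo9K i).len a ^ 4)⁻¹))
    {ε₃ : ℝ} (hε₃w : ((d : ℝ) + 1) *
          (κL * ((M₂ * ∑ j, ‖b j‖) ^ 2 * B₁) * κPb * κT2 * (CS * C1) * B6.c1 dBw δ₀w βw ^ 2 * Real.exp (-(asepw * (3 / 8 * (i.Mh : ℝ) - 1))) +
            κL * ((M₂ * ∑ j, ‖b j‖) ^ 2 * B₁) * (M₂ * (∑ j, ‖b j‖) * BG) ^ 2 * (M₂ * ∑ j, ‖b j‖) ^ 2 * κT0 * (CS * CA ^ 2 * CT3) * B6.c1 dBw δ₀w βw ^ 4 *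
              Real.exp (-(asepw * (3 / 8 * (i.Mh : ℝ) - 1))) +
            κL * ((M₂ * ∑ j, ‖b j‖) ^ 2 * B₁) * (M₂ * (∑ j, ‖b j‖) * BG) ^ 2 * ((M₂ * ∑ j, ‖b j‖) ^ 2 * (θ * B6.c1 dBc δc αc)) * κT0 * (CS * CA ^ 2 * CT3) *
              B6.c1 dBw δ₀w βw ^ 5 * Real.exp (-(asepw * (3 / 8 * (i.Mh : ℝ) - 2))) +
            κL * ((M₂ * ∑ j, ‖b j‖) ^ 2 * B₁) * (M₂ * (∑ j, ‖b j‖) * BG) * ((M₂ * ∑ j, ‖b j‖) ^ 2 * (θ * B6.c1 dBc δc αc)) * κT1 * (CS * CA * CT1) *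
              B6.c1 dBw δ₀w βw ^ 4 * Real.exp (-(asepw * (3 / 8 * (i.Mh : ℝ) - 2))) +
            κL * ((M₂ * ∑ j, ‖b j‖) ^ 2 * B₁) * κR * (CS * C1) * B6.c1 dBw δ₀w βw ^ 2 * Real.exp (-(asepw * (3 / 8 * (i.Mh : ℝ) - 1))) +
            κL * κSb * κR * (CS * C1) * B6.c1 dBw δ₀w βw ^ 2 * Real.exp (-(asepw * (3 / 8 * (i.Mh : ℝ) - 1))) +
            κL * Real.exp (-(asepw * (3 / 8 * (i.Mh : ℝ) - 1))) * (((M₂ * ∑ j, ‖b j‖) ^ 2 * B₁) * κR * C1 * B6.c1 dBw δ₀w βw) * CT3 * B6.c1 dBw δ₀w βw +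
            κL * Real.exp (-(asepw * (3 / 8 * (i.Mh : ℝ) - 1))) * κG * CT3 * B6.c1 dBw δ₀w βw) ≤ ε₃)
    (hρw : ρ ≤ r₀ - 5 * ((αw + βw) * δ₀w) - asepw)
    (dC : ℕ) {KC δC αC : ℝ} (hKC : 0 ≤ KC) (hδC : 0 ≤ δC) (hαC1 : αC ≤ 1)
    (h261C : ∀ c : ↥(cubes i.D.toDomains), Ineq261 dC (toB6 (geoCK i c) RC HC) δC αC)
    (hPlC : ∀ c : ↥(cubes i.D.toDomains), HasMajorant (g := toB6 (geoCK i c) RC HC) (blkBK i c)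
      (conj b ((DPDsCubeY i c (parSymY i) (locCfgY i c η (A c))).restrictScalars ℝ))
      (fun a s' => KC * ((geoCK i c).len a ^ 2)⁻¹ * Real.exp (-(δC * (geoCK i c).dist a s'))))
    (dB' : ℕ) {asep ρ₁ ρ' αst Λ' : ℝ} (hasep : 0 ≤ asep) (hΛ' : 0 ≤ Λ') (hρ' : 0 ≤ ρ')
    (hsplitP : asep + ρ₁ ≤ ρ / δ) (hsplitC : asep * δ + ρ₁ * δ ≤ (1 - αC) * δC) (hsplit : αst + ρ' ≤ 1)
    (h261' : Ineq261 dB' (toB6 (geo9K i) Rr Hp) δ (ρ₁ - ρ')) (hST : ScaleTransfer (geo9K i) δ αst Λ' (fun a => ((geo9K i).len a ^ 2)⁻¹)) :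
    HasMajorant (g := toB6 (geo9K i) Rr Hp) (fun p : FBondY i × ι => ιB (blkV1 i.hN i.D p.1))
      (∑ c : ↥(cubes i.D.toDomains), conj b ((cutMulY (𝔸 := 𝔸) (hBdY i (hTY i c)) * Oc c (cfg U₁) * cutMulY (𝔸 := 𝔸) (hBdY i (hTY i c)) *
        (cutMulY (𝔸 := 𝔸) (hBdY i (zetaY i c)) *
          (DPDsY i (parSymY i) (fun W => GpY i (parSymY i) W) (cfg U₁) - locProjBY i c (parSymY i) (u c) (locCfgY i c η (A c))))).restrictScalars ℝ))
      (fun a b' => (3 * 5 ^ (d + 1)) *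
        (((M₂ * (∑ j, ‖b j‖) * B₀) *
            ((((M₂ * ∑ j, ‖b j‖) * (M₂ * ∑ j, ‖b j‖) * B₁ * Λ ^ 4 * B6.c1 dB δ₀ β' ^ 2 *
                  (((d : ℝ) + 1) * εT * (2 * (M₂ * (∑ j, ‖b j‖) * BG) + εT)) + ε₃) +
              (kappa349 (M₂ * ∑ j, ‖b j‖) (((d : ℝ) + 1) * (M₂ * (∑ j, ‖b j‖) * BG)) B₁ Λ (B6.c1 dB δ₀ β') +
                (M₂ * ∑ j, ‖b j‖) ^ 2 * (KC * B6.c1 dC δC αC)) * Real.exp (-(asep * δ * DsepT i)))) * Λ' * B6.c1 dB' δ (ρ₁ - ρ')) *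
          Real.exp (-(ρ' * δ * (geo9K i).dist a b')))) := by
  obtain ⟨-, -, hdnn⟩ := geo9K_axioms i Rr Hp
  have hSum : 0 ≤ M₂ * ∑ j, ‖b j‖ := mul_nonneg hM₂ (Finset.sum_nonneg fun j _ => norm_nonneg _)
  have hc1w : 0 ≤ B6.c1 dBw δ₀w βw := c1_nonneg _ _ _
  have hc1c : 0 ≤ B6.c1 dBc δc αc := c1_nonneg _ _ _
  -- F3-B3 FILE 6: the located `C`-difference word, folded to `ε₃·ℓ(a)⁻²·e^{−ρd}` (exactly as in p33's FILE 7)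
  have hε₃0 : 0 ≤ ε₃ := le_trans (by positivity) hε₃w
  have hP3 : ∀ c : ↥(cubes i.D.toDomains), HasMajorant (g := toB6 (geo9K i) Rr Hp) (fun p : FBondY i × ι => ιB (blkV1 i.hN i.D p.1))
      (conj b ((gradY i (cfg U₁) ∘ₗ (cutMulY (𝔸 := 𝔸) (bumpY i (ctrR i c) (3 * (SC i c : ℝ))) ∘ₗ
        (GpCubeY i c (parSymY i) (gaugeY i (u c)⁻¹ (locCfgY i c η (A c))) ∘ₗ
          ((QpsY i (parSymY i) (cfg U₁) ∘ₗ XinvY i (parSymY i) (fun W => GpY i (parSymY i) W) (cfg U₁) ∘ₗ QpY i (parSymY i) (cfg U₁))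
            - (QpsCubeY i c (parSymY i) (gaugeY i (u c)⁻¹ (locCfgY i c η (A c))) ∘ₗ
                XinvCubeY i c (parSymY i) (gaugeY i (u c)⁻¹ (locCfgY i c η (A c))) ∘ₗ
                QpCubeY i c (parSymY i) (gaugeY i (u c)⁻¹ (locCfgY i c η (A c))))) ∘ₗ
          GpCubeY i c (parSymY i) (gaugeY i (u c)⁻¹ (locCfgY i c η (A c)))) ∘ₗ
        cutMulY (𝔸 := 𝔸) (bumpY i (ctrR i c) (3 * (SC i c : ℝ)))) ∘ₗ divY i (cfg U₁)).restrictScalars ℝ))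
      (fun a y => ε₃ * ((geo9K i).len a ^ 2)⁻¹ * Real.exp (-(ρ * (geo9K i).dist a y))) := fun c => by
    refine hasMajorant_mono (g := toB6 (geo9K i) Rr Hp) _
      (hasMajorant_hP3_of_tails i c b cfg hE hBG ιB hι hpar hM₂ hrepr hη hs hB₁ hCinv (u c) (hu c) (A c) (Q c) η (hQ c) (hgA c) hX (hXc c) hU (hV c) dBc
        hθ hδc hαc1 hrate (h261c c) (hR c) dBw hκL hκPb hκT0 hκT1 hκT2 hκSb hκR hκG hCS hCA hCT3 hCT1 hC1 hαδw hε0w hasepw hρw0 hrSw hrAw hrcw hrT0 hrT1 hrT2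
        hrSb hrR hrG hST4w hST2w hST3w hSTm1w hST1w h261w (hLw c) (hRop c) (hTail0 c) (hTail1 c) (hTail2 c) (hSbL c) (hGw c) (hPb c)) fun a y => ?_
    have hl : 0 ≤ ((geo9K i).len a ^ 2)⁻¹ := by have := (geo9K_len_pos i a).le; positivity
    refine mul_le_mul (mul_le_mul_of_nonneg_right hε₃w hl) (Real.exp_le_exp.2 (neg_le_neg (mul_le_mul_of_nonneg_right hρw (hdnn a y)))) (Real.exp_nonneg _)
      (mul_nonneg hε₃0 hl)
  exact hasMajorant_sum_famThreeT_at_locCfg_chiL i b cfg par hE hBG hδG0 Oc hB₀ hδ hEO ιB hι hpar hM₂ hrepr hη hs hB₁ hCinv u hu A Q η hQ hgA hU hV RC HC dBc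
    dBE hθ hδc hαc1 hasepE hρE hsplitE hrate h261c h261E hR hεDT hδDT dBt hθt hδt hαt1 h261t hT dBR hδ₀R haG hαR hΛR hT1R hΛstR hTstR hasepR hρR hsplitL hrateR
    hsplitR h261R hεRT hδRT dB hΛ hρ hα hβ hδ₀ hδG' hδX' hδD' hr h261 hT1 hT2 hT4 hε₃0 hP3 dC hKC hδC hαC1 h261C hPlC dB' hasep hΛ' hρ' hsplitP hsplitC hsplit
    h261' hST

end Record

end Literature.MathematicalPhysics.QuantumFieldTheory.Balaban1983to89.B9Eq3105FamThreeTAtLocCfgOfTails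

end
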